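import Summits.CriticalPhenomena.CardyFormulaZ2.Theorems.CardySelfDualSegmentUniformMarginalityDefs2
import Summits.CriticalPhenomena.CardyFormulaZ2.Theorems.CardySelfDualSegmentUniformMarginalityStubRussoIdentity

/-!
# Sub-goal (R_E) `stub_russoIdentityEast` of line `Sketch` for the crux `UniformMarginality`
(stmt-CriticalPhenomena-5472): the east twin of the Russo identity,
`∂_t P_t(R,δ) = ½ Σ_{v ∈ K} E_t[(1 − 2 n_v) 𝟙{E_v pivotal}]` for `t ∈ (0,1)` and `δ > 0`
(`n_v = 𝟙{N_v open}`).

Proof (the east/north symmetry of the corner law, realised on the coin space). The recoding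
`Ψ = blockMap transposeBit`, `(c_v, d_v) ↦ (c_v ≠ d_v, d_v)` at every vertex, preserves
`prodBernoulli (cornerParam t)` (`prodBernoulli_cornerParam_map_blockMap`: for each value of
the splitting bit it permutes the two values of the FAIR coin), hence
`M_t = (prodBernoulli (cornerParam t)).map (cornerConfig ∘ Ψ)` and
`Pext R δ b = (prodBernoulli (cornerParam (projIcc b))).real ((cornerConfig ∘ Ψ) ⁻¹' A)`,
`A = crossEvent R δ`. In the transposed coding `cornerConfig ∘ Ψ` the roles of the two edges
of the corner at `v` are exchanged: the NORTH edge is open iff the coin `c_v = 1`, and the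
EAST edge is open iff `c_v ≠ d_v`. The proof of (R)
(`CardySelfDualSegmentUniformMarginalityStubRussoIdentity.lean`) then goes through verbatim
with `east ↔ north`: the unsigned Russo formula `hasDerivAt_prodBernoulli_real_sub` along the
path `b ↦ cornerParam (projIcc 0 1 b)` (coins: derivative `0`; splitting bits: `1/2`) for the
cylinder event `(cornerConfig ∘ Ψ) ⁻¹' A`, `integral_map`, and the pointwise identity
`russoIntegrandEast A v (cornerConfig (Ψ S)) = 𝟙_A(cornerConfig (Ψ (insert (v,1) S))) −
𝟙_A(cornerConfig (Ψ (S \ {(v,1)})))` (in the transposed coding, flipping the splitting bit of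
`v` flips exactly the EAST edge of `v`, towards `open` iff the north edge of `v` is closed).
-/

noncomputable section

namespace Summit.CriticalPhenomena.CardyFormulaZ2.Cruxes.UniformMarginality.HeatFlow

open MeasureTheory Literature.Probability.Percolation Literature.Probability.LatticeModels
  Literature.Probability.RandomPlanarGeometry
open scoped Classical

/-! ## §1 Measurability and two set identities on configuration spaces `Set α` -/

section SetSpace

variable {α : Type*}

/-- Switching a coordinate on is measurable. -/
private theorem measurable_insert' (a : α) : Measurable (insert a : Set α → Set α) :=
  measurable_set_iff.2 fun x => by
    simp only [Set.mem_insert_iff]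
    exact measurable_const.or (measurable_set_mem x)

/-- Switching a coordinate off is measurable. -/
private theorem measurable_sdiff_singleton' (a : α) : Measurable (· \ {a} : Set α → Set α) :=
  measurable_set_iff.2 fun x => (measurable_set_mem x).and measurable_const

/-- The pivotality event of a measurable event is measurable. -/
private theorem measurableSet_isPivotal' {A : Set (Set α)} (hA : MeasurableSet A) (a : α) :
    MeasurableSet {S : Set α | IsPivotal A a S} := by
  have h1 : MeasurableSet {S : Set α | insert a S ∈ A} := measurable_insert' a hA
  have h2 : MeasurableSet {S : Set α | S \ {a} ∈ A} := measurable_sdiff_singleton' a hA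
  have h : {S : Set α | IsPivotal A a S} = ({S | insert a S ∈ A} ∩ {S | S \ {a} ∈ A}ᶜ) ∪
      ({S | S \ {a} ∈ A} ∩ {S | insert a S ∈ A}ᶜ) := by
    ext S
    simp only [IsPivotal, Xor, Set.mem_setOf_eq, Set.mem_union, Set.mem_inter_iff,
      Set.mem_compl_iff]
  rw [h]
  exact (h1.inter h2.compl).union (h2.inter h1.compl)

/-- A set containing `a` and agreeing with `ω` off `a` is `insert a ω`. -/
private theorem eq_insert_of_forall_ne {T ω : Set α} {a : α} (ha : a ∈ T)
    (h : ∀ x, x ≠ a → (x ∈ T ↔ x ∈ ω)) : T = insert a ω := by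
  ext x
  by_cases hx : x = a
  · subst hx; simp [ha]
  · simp [hx, h x hx]

/-- A set avoiding `a` and agreeing with `ω` off `a` is `ω \ {a}`. -/
private theorem eq_sdiff_of_forall_ne {T ω : Set α} {a : α} (ha : a ∉ T)
    (h : ∀ x, x ≠ a → (x ∈ T ↔ x ∈ ω)) : T = ω \ {a} := by
  ext x
  by_cases hx : x = a
  · subst hx; simp [ha]
  · simp [hx, h x hx]

end SetSpace

/-! ## §2 The transposed coding `cornerConfig ∘ blockMap transposeBit` -/

/-- Membership in the transposed corner configuration: the east edge of `w` is open iff the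
coin and the splitting bit of `w` disagree, the north edge of `w` iff the coin shows `1`. -/
private theorem mem_cornerConfigT_iff (S : Set (Site 2 × Fin 2)) (e : Sym2 (Site 2)) :
    e ∈ cornerConfig (blockMap transposeBit S) ↔ ∃ w : Site 2,
      (e = s(w, w + ![1, 0]) ∧ ((w, (0 : Fin 2)) ∈ S ↔ (w, (1 : Fin 2)) ∉ S)) ∨
        (e = s(w, w + ![0, 1]) ∧ (w, (0 : Fin 2)) ∈ S) := by
  rw [mem_cornerConfig_iff]
  refine exists_congr fun w => ?_
  simp only [mem_blockMap_iff, transposeBit, Fin.isValue, ↓reduceIte, one_ne_zero]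
  tauto

/-- In the transposed coding the east edge of `v` is open iff `c_v ≠ d_v`. -/
private theorem east_mem_cornerConfigT_iff (S : Set (Site 2 × Fin 2)) (v : Site 2) :
    eastEdge v ∈ cornerConfig (blockMap transposeBit S) ↔
      ((v, (0 : Fin 2)) ∈ S ↔ (v, (1 : Fin 2)) ∉ S) := by
  rw [eastEdge, east_mem_cornerConfig_iff, mem_blockMap_iff]
  simp [transposeBit]

/-- In the transposed coding the north edge of `v` is open iff the coin `c_v = 1`. -/
private theorem north_mem_cornerConfigT_iff (S : Set (Site 2 × Fin 2)) (v : Site 2) :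
    northEdge v ∈ cornerConfig (blockMap transposeBit S) ↔ (v, (0 : Fin 2)) ∈ S := by
  rw [northEdge, north_mem_cornerConfig_iff, mem_blockMap_iff, mem_blockMap_iff]
  simp only [transposeBit, Fin.isValue, ↓reduceIte, one_ne_zero]
  tauto

/-- The transposed coding is measurable. -/
private theorem measurable_cornerConfigT :
    Measurable (cornerConfig ∘ blockMap transposeBit : Set (Site 2 × Fin 2) → BondConfig (Site 2)) :=
  measurable_cornerConfig.comp (measurable_blockMap _)

/-- **`M_b` through the transposed coding**: `M_b = (prodBernoulli (cornerParam (projIcc b))).map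
(cornerConfig ∘ Ψ)`, since `Ψ = blockMap transposeBit` preserves `prodBernoulli (cornerParam ·)`. -/
private theorem M_eq_map_cornerConfigT (b : ℝ) :
    M b = (prodBernoulli (cornerParam (Set.projIcc (0 : ℝ) 1 zero_le_one b))).map
      (cornerConfig ∘ blockMap transposeBit) := by
  rw [← Measure.map_map measurable_cornerConfig (measurable_blockMap _),
    prodBernoulli_cornerParam_map_blockMap _ transposeBit_involutive transposeBit_one]
  rfl

/-- **`Pext` through the transposed coding**: `Pext R δ b` is the
`prodBernoulli (cornerParam (projIcc b))`-probability of the transposed coin-space event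
`(cornerConfig ∘ Ψ) ⁻¹' (crossEvent R δ)`. -/
private theorem Pext_eq_cornerConfigT (R : ConformalRectangle) (δ b : ℝ) :
    Pext R δ b = (prodBernoulli (cornerParam (Set.projIcc (0 : ℝ) 1 zero_le_one b))).real
      ((cornerConfig ∘ blockMap transposeBit) ⁻¹' crossEvent R δ) := by
  rw [Pext_eq, Set.preimage_comp, ← map_measureReal_apply (measurable_blockMap _)
    (measurable_cornerConfig (measurableSet_crossEvent R δ)),
    prodBernoulli_cornerParam_map_blockMap _ transposeBit_involutive transposeBit_one]
  rfl

/-- For `δ > 0` the transposed coin-space event is a cylinder event over the coins and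
splitting bits of the finitely many vertices of `verts R δ` (`Ψ` acts vertex by vertex). -/
private theorem determinedBy_coinEventT (R : ConformalRectangle) {δ : ℝ} (hδ : 0 < δ) :
    DeterminedBy ((cornerConfig ∘ blockMap transposeBit) ⁻¹' crossEvent R δ)
      ↑((verts_finite R hδ).toFinset ×ˢ (Finset.univ : Finset (Fin 2))) := by
  have hE := (determinedBy_iff _ _).1 (determinedBy_coinEvent R hδ)
  rw [determinedBy_iff]
  intro S S' hSS'
  -- the two coin sets have the same pair of bits at every vertex of `verts R δ`
  have hfun : ∀ w ∈ (verts_finite R hδ).toFinset,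
      (fun j : Fin 2 => (w, j) ∈ S) = fun j : Fin 2 => (w, j) ∈ S' := by
    intro w hw
    funext j
    have hmem : (w, j) ∈ (↑((verts_finite R hδ).toFinset ×ˢ (Finset.univ : Finset (Fin 2))) :
        Set (Site 2 × Fin 2)) := by
      rw [Finset.coe_product, Finset.coe_univ]
      exact ⟨hw, Set.mem_univ _⟩
    refine propext ⟨fun h => ?_, fun h => ?_⟩
    · exact ((Set.ext_iff.1 hSS' (w, j)).1 ⟨h, hmem⟩).1
    · exact ((Set.ext_iff.1 hSS' (w, j)).2 ⟨h, hmem⟩).1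
  -- hence the recoded coin sets agree on the cylinder coordinates
  have hagree : blockMap transposeBit S ∩
      ↑((verts_finite R hδ).toFinset ×ˢ (Finset.univ : Finset (Fin 2))) =
      blockMap transposeBit S' ∩
        ↑((verts_finite R hδ).toFinset ×ˢ (Finset.univ : Finset (Fin 2))) := by
    ext i
    have hw : i ∈ (↑((verts_finite R hδ).toFinset ×ˢ (Finset.univ : Finset (Fin 2))) :
        Set (Site 2 × Fin 2)) → i.1 ∈ (verts_finite R hδ).toFinset := fun hiF =>
      (Finset.mem_product.1 (Finset.mem_coe.1 hiF)).1
    simp only [Set.mem_inter_iff]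
    constructor
    · rintro ⟨hi, hiF⟩
      refine ⟨?_, hiF⟩
      rw [mem_blockMap_iff] at hi ⊢
      rwa [← hfun i.1 (hw hiF)]
    · rintro ⟨hi, hiF⟩
      refine ⟨?_, hiF⟩
      rw [mem_blockMap_iff] at hi ⊢
      rwa [hfun i.1 (hw hiF)]
  have key := hE (blockMap transposeBit S) (blockMap transposeBit S') hagree
  simpa only [coinEvent, Set.mem_setOf_eq, Set.mem_preimage, Function.comp_apply] using key

/-! ## §3 In the transposed coding, flipping a splitting bit flips exactly the east edge -/

/-- Coin sets agreeing off the splitting bit `(v,1)` have transposed corner configurations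
agreeing off the east edge of `v`. -/
private theorem mem_cornerConfigT_congr_off {S S' : Set (Site 2 × Fin 2)} {v : Site 2}
    (h : ∀ i, i ≠ (v, (1 : Fin 2)) → (i ∈ S ↔ i ∈ S')) {e : Sym2 (Site 2)}
    (he : e ≠ eastEdge v) :
    e ∈ cornerConfig (blockMap transposeBit S) ↔ e ∈ cornerConfig (blockMap transposeBit S') := by
  rw [mem_cornerConfigT_iff, mem_cornerConfigT_iff]
  refine exists_congr fun w => ?_
  have h0 : (w, (0 : Fin 2)) ∈ S ↔ (w, (0 : Fin 2)) ∈ S' := h _ (by simp)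
  by_cases hw : w = v
  · have hE : e ≠ s(w, w + ![1, 0]) := by rw [hw]; exact he
    simp only [hE, false_and, false_or, h0]
  · have h1 : (w, (1 : Fin 2)) ∈ S ↔ (w, (1 : Fin 2)) ∈ S' := h _ (by simp [hw])
    rw [h0, h1]

/-- North edge open (coin `1`), splitting bit switched on: the east edge of `v` closes,
nothing else moves. -/
private theorem cornerConfigT_insert_of_mem {S : Set (Site 2 × Fin 2)} {v : Site 2}
    (hc : (v, (0 : Fin 2)) ∈ S) :
    cornerConfig (blockMap transposeBit (insert (v, (1 : Fin 2)) S)) =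
      cornerConfig (blockMap transposeBit S) \ {eastEdge v} := by
  refine eq_sdiff_of_forall_ne ?_ fun e he => mem_cornerConfigT_congr_off (fun i hi => ?_) he
  · rw [east_mem_cornerConfigT_iff]
    simp [hc]
  · simp [Set.mem_insert_iff, hi]

/-- North edge open (coin `1`), splitting bit switched off: the east edge of `v` opens,
nothing else moves. -/
private theorem cornerConfigT_sdiff_of_mem {S : Set (Site 2 × Fin 2)} {v : Site 2}
    (hc : (v, (0 : Fin 2)) ∈ S) :
    cornerConfig (blockMap transposeBit (S \ {(v, (1 : Fin 2))})) =
      insert (eastEdge v) (cornerConfig (blockMap transposeBit S)) := by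
  refine eq_insert_of_forall_ne ?_ fun e he => mem_cornerConfigT_congr_off (fun i hi => ?_) he
  · rw [east_mem_cornerConfigT_iff]
    simp [hc]
  · simp [hi]

/-- North edge closed (coin `0`), splitting bit switched on: the east edge of `v` opens,
nothing else moves. -/
private theorem cornerConfigT_insert_of_not_mem {S : Set (Site 2 × Fin 2)} {v : Site 2}
    (hc : (v, (0 : Fin 2)) ∉ S) :
    cornerConfig (blockMap transposeBit (insert (v, (1 : Fin 2)) S)) =
      insert (eastEdge v) (cornerConfig (blockMap transposeBit S)) := by
  refine eq_insert_of_forall_ne ?_ fun e he => mem_cornerConfigT_congr_off (fun i hi => ?_) he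
  · rw [east_mem_cornerConfigT_iff]
    simp [hc]
  · simp [Set.mem_insert_iff, hi]

/-- North edge closed (coin `0`), splitting bit switched off: the east edge of `v` closes,
nothing else moves. -/
private theorem cornerConfigT_sdiff_of_not_mem {S : Set (Site 2 × Fin 2)} {v : Site 2}
    (hc : (v, (0 : Fin 2)) ∉ S) :
    cornerConfig (blockMap transposeBit (S \ {(v, (1 : Fin 2))})) =
      cornerConfig (blockMap transposeBit S) \ {eastEdge v} := by
  refine eq_sdiff_of_forall_ne ?_ fun e he => mem_cornerConfigT_congr_off (fun i hi => ?_) he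
  · rw [east_mem_cornerConfigT_iff]
    simp [hc]
  · simp [hi]

/-- **Pointwise east Russo identity in the transposed coding.** For an increasing event `A`,
the east Russo integrand at `v` on `cornerConfig (Ψ S)` is the difference of the indicators of
`A` at the transposed corner configurations of `S` with the splitting bit of `v` switched on
and off: flipping `d_v` flips exactly `E_v`, in the direction `closed → open` iff `N_v` is
closed (coin `0`). -/
private theorem russoIntegrandEast_cornerConfigT {A : Set (BondConfig (Site 2))}
    (hA : IsUpperSet A) (v : Site 2) (S : Set (Site 2 × Fin 2)) :
    russoIntegrandEast A v (cornerConfig (blockMap transposeBit S)) =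
      {S | insert (v, (1 : Fin 2)) S ∈ (cornerConfig ∘ blockMap transposeBit) ⁻¹' A}.indicator
          (fun _ => (1 : ℝ)) S -
        {S | S \ {(v, (1 : Fin 2))} ∈ (cornerConfig ∘ blockMap transposeBit) ⁻¹' A}.indicator
          (fun _ => (1 : ℝ)) S := by
  simp only [Set.indicator_apply, Set.mem_setOf_eq, Set.mem_preimage, Function.comp_apply]
  unfold russoIntegrandEast IsPivotal Xor
  have hN : northEdge v ∈ cornerConfig (blockMap transposeBit S) ↔ (v, (0 : Fin 2)) ∈ S :=
    north_mem_cornerConfigT_iff S v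
  have hmono : cornerConfig (blockMap transposeBit S) \ {eastEdge v} ∈ A →
      insert (eastEdge v) (cornerConfig (blockMap transposeBit S)) ∈ A :=
    fun h => hA (Set.sdiff_subset.trans (Set.subset_insert _ _)) h
  by_cases hc : (v, (0 : Fin 2)) ∈ S
  · have hNv : northEdge v ∈ cornerConfig (blockMap transposeBit S) := hN.2 hc
    simp only [cornerConfigT_insert_of_mem hc, cornerConfigT_sdiff_of_mem hc, hNv, if_true]
    by_cases h1 : insert (eastEdge v) (cornerConfig (blockMap transposeBit S)) ∈ A
    · by_cases h2 : cornerConfig (blockMap transposeBit S) \ {eastEdge v} ∈ A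
      · simp [h1, h2]
      · simp [h1, h2]
    · have h2 : cornerConfig (blockMap transposeBit S) \ {eastEdge v} ∉ A :=
        fun h => h1 (hmono h)
      simp [h1, h2]
  · have hNv : northEdge v ∉ cornerConfig (blockMap transposeBit S) := fun h => hc (hN.1 h)
    simp only [cornerConfigT_insert_of_not_mem hc, cornerConfigT_sdiff_of_not_mem hc, hNv,
      if_false]
    by_cases h1 : insert (eastEdge v) (cornerConfig (blockMap transposeBit S)) ∈ A
    · by_cases h2 : cornerConfig (blockMap transposeBit S) \ {eastEdge v} ∈ A
      · simp [h1, h2]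
      · simp [h1, h2]
    · have h2 : cornerConfig (blockMap transposeBit S) \ {eastEdge v} ∉ A :=
        fun h => h1 (hmono h)
      simp [h1, h2]

/-! ## §4 The `v`-th east Russo term as an expectation on bond configurations -/

/-- The east Russo integrand is measurable. -/
private theorem measurable_russoIntegrandEast {A : Set (BondConfig (Site 2))}
    (hA : MeasurableSet A) (v : Site 2) : Measurable (russoIntegrandEast A v) := by
  unfold russoIntegrandEast
  refine Measurable.mul ?_ ?_
  · exact Measurable.ite (measurableSet_mem _) measurable_const measurable_const
  · exact Measurable.ite (measurableSet_isPivotal' hA _) measurable_const measurable_const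

/-- For a measurable increasing event `A` and `μ = prodBernoulli P`, the
`μ.map (cornerConfig ∘ Ψ)`-expectation of `X^E_v` is
`μ(cornerConfig (Ψ (insert (v,1) S)) ∈ A) − μ(cornerConfig (Ψ (S \ {(v,1)})) ∈ A)`. -/
private theorem integral_russoIntegrandEast {A : Set (BondConfig (Site 2))}
    (hA : MeasurableSet A) (hA' : IsUpperSet A) (v : Site 2)
    (P : Site 2 × Fin 2 → unitInterval) :
    ∫ ω, russoIntegrandEast A v ω ∂((prodBernoulli P).map (cornerConfig ∘ blockMap transposeBit)) =
      (prodBernoulli P).real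
          {S | insert (v, (1 : Fin 2)) S ∈ (cornerConfig ∘ blockMap transposeBit) ⁻¹' A} -
        (prodBernoulli P).real
          {S | S \ {(v, (1 : Fin 2))} ∈ (cornerConfig ∘ blockMap transposeBit) ⁻¹' A} := by
  have h1 : MeasurableSet
      {S | insert (v, (1 : Fin 2)) S ∈ (cornerConfig ∘ blockMap transposeBit) ⁻¹' A} :=
    measurable_insert' (v, (1 : Fin 2)) (measurable_cornerConfigT hA)
  have h2 : MeasurableSet
      {S | S \ {(v, (1 : Fin 2))} ∈ (cornerConfig ∘ blockMap transposeBit) ⁻¹' A} :=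
    measurable_sdiff_singleton' (v, (1 : Fin 2)) (measurable_cornerConfigT hA)
  rw [integral_map measurable_cornerConfigT.aemeasurable
    (measurable_russoIntegrandEast hA v).aestronglyMeasurable,
    show (fun S => russoIntegrandEast A v ((cornerConfig ∘ blockMap transposeBit) S)) = fun S =>
      {S | insert (v, (1 : Fin 2)) S ∈ (cornerConfig ∘ blockMap transposeBit) ⁻¹' A}.indicator
          (fun _ => (1 : ℝ)) S -
        {S | S \ {(v, (1 : Fin 2))} ∈ (cornerConfig ∘ blockMap transposeBit) ⁻¹' A}.indicator
          (fun _ => (1 : ℝ)) S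
      from funext fun S => russoIntegrandEast_cornerConfigT hA' v S,
    integral_sub ((integrable_const (1 : ℝ)).indicator h1)
      ((integrable_const (1 : ℝ)).indicator h2),
    integral_indicator_const (1 : ℝ) h1, integral_indicator_const (1 : ℝ) h2, smul_eq_mul,
    mul_one, smul_eq_mul, mul_one]

/-! ## §5 The path of parameters -/

/-- The coin coordinate of the path is the constant `1/2`: derivative `0`. -/
private theorem hasDerivAt_coe_cornerParam_zero (v : Site 2) (t : ℝ) :
    HasDerivAt (fun b : ℝ =>
      ((cornerParam (Set.projIcc (0 : ℝ) 1 zero_le_one b) (v, 0) : unitInterval) : ℝ)) 0 t := by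
  simp only [cornerParam_apply_zero, coe_half]
  exact hasDerivAt_const t _

/-- The splitting coordinate of the path is `b / 2` near `t ∈ (0,1)`: derivative `1/2`. -/
private theorem hasDerivAt_coe_cornerParam_one (v : Site 2) {t : ℝ}
    (ht : t ∈ Set.Ioo (0 : ℝ) 1) :
    HasDerivAt (fun b : ℝ =>
      ((cornerParam (Set.projIcc (0 : ℝ) 1 zero_le_one b) (v, 1) : unitInterval) : ℝ))
      (1 / 2) t := by
  simp only [coe_cornerParam_apply_one]
  have h : HasDerivAt (fun b : ℝ => b / 2) (1 / 2) t := (hasDerivAt_id' t).div_const 2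
  refine h.congr_of_eventuallyEq ?_
  filter_upwards [Ioo_mem_nhds ht.1 ht.2] with b hb
  rw [Set.projIcc_of_mem zero_le_one (Set.Ioo_subset_Icc_self hb)]

/-! ## §6 The sub-goal -/

/-- SUB-GOAL (R_E) of line `Sketch`: **the east twin of the Russo / heat-flow identity for the
corner family**. For `δ > 0`, with `K` the (finite) set of vertices whose mesh point lies in
the carrier of `R`, no east edge outside `K` is ever pivotal for the crude crossing event, and
for every `t ∈ (0,1)`, `∂_t P_t(R,δ) = ½ Σ_{v ∈ K} E_t[(1 − 2 n_v) 𝟙{E_v pivotal}]`. -/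
theorem stub_russoIdentityEast : RussoIdentityEast := by
  intro R δ hδ
  refine ⟨(verts_finite R hδ).toFinset, fun ω v hv => not_isPivotal_eastEdge R hδ hv ω, ?_⟩
  intro t ht
  set p : ℝ → Site 2 × Fin 2 → unitInterval :=
    fun b => cornerParam (Set.projIcc (0 : ℝ) 1 zero_le_one b) with hp
  set p' : Site 2 × Fin 2 → ℝ := fun i => if i.2 = 0 then 0 else 1 / 2 with hp'
  have hp'0 : ∀ v : Site 2, p' (v, 0) = 0 := fun v => by simp [hp']
  have hp'1 : ∀ v : Site 2, p' (v, 1) = 1 / 2 := fun v => by simp [hp']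
  have hpd : ∀ i ∈ (verts_finite R hδ).toFinset ×ˢ (Finset.univ : Finset (Fin 2)),
      HasDerivAt (fun b => (p b i : ℝ)) (p' i) t := by
    rintro ⟨v, j⟩ -
    by_cases hj : j = 0
    · subst hj; rw [hp'0]; exact hasDerivAt_coe_cornerParam_zero v t
    · obtain rfl : j = 1 := Fin.eq_one_of_ne_zero j hj
      rw [hp'1]; exact hasDerivAt_coe_cornerParam_one v ht
  have hmain := hasDerivAt_prodBernoulli_real_sub p (determinedBy_coinEventT R hδ) t p' hpd
  -- the derivative is the east Russo sum
  have hsum : (∑ e ∈ (verts_finite R hδ).toFinset ×ˢ (Finset.univ : Finset (Fin 2)),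
      p' e * ((prodBernoulli (p t)).real
          {S | insert e S ∈ (cornerConfig ∘ blockMap transposeBit) ⁻¹' crossEvent R δ} -
        (prodBernoulli (p t)).real
          {S | S \ {e} ∈ (cornerConfig ∘ blockMap transposeBit) ⁻¹' crossEvent R δ})) =
      (1 / 2 : ℝ) * ∑ v ∈ (verts_finite R hδ).toFinset,
        ∫ ω, russoIntegrandEast (crossEvent R δ) v ω ∂(M t) := by
    rw [Finset.sum_product, Finset.mul_sum]
    refine Finset.sum_congr rfl fun v _ => ?_
    rw [Fin.sum_univ_two, hp'0, hp'1, zero_mul, zero_add]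
    congr 1
    rw [M_eq_map_cornerConfigT]
    exact (integral_russoIntegrandEast (measurableSet_crossEvent R δ) (isUpperSet_crossEvent R δ)
      v _).symm
  -- and the differentiated function is `Pext R δ`
  have hfun : Pext R δ = fun b => (prodBernoulli (p b)).real
      ((cornerConfig ∘ blockMap transposeBit) ⁻¹' crossEvent R δ) :=
    funext fun b => Pext_eq_cornerConfigT R δ b
  rw [hfun]
  rwa [hsum] at hmain

end Summit.CriticalPhenomena.CardyFormulaZ2.Cruxes.UniformMarginality.HeatFlow

end
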